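import Mathlib
import HarnessLib
import Summits.ResolutionOfSingularities.ResolutionOfSingularities.Theorems.WildQuotientsWildQuotientResolutionS1aJInf

/-!
# S1a — REACHABILITY and the DATUM-RELATIVE residual `KillOrAuxRuleJInfReach` (plan-1 SIG KA v1, F-DIM), typed (K)/(A) halves, (A0)

[OURS · L1 W4.5c · lead-1 g8 filing plan-1 g12's SIG KA v1 `L/w45c/W45cKAv1.lean` 7a61f0360dd40940 verbatim (defs + the two assembly lemmas; the
`Theses`-cone wrapper `winningStrategy_of_killOrAuxRuleJInfReach` lives in `…S1aWinsOfReach`); STRATEGY-DESIGN v3.3 §0] — NOT statements of the manuscript;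
counted 0; AI-level work, weaker than expert review. Crux stmt-ResolutionOfSingularities-17941, line `s1a-logminvertex` v6, stub `stub_winningStrategy`.

FINDING F-DIM (plan-1 g12 / lead-1 g8 flag): `KillOrAuxRuleJInf p` quantifies over ALL data and ALL Noetherian-base models in every dimension, whereas
`WinningStrategy p` only needs the INITIAL model of a CRUX DATUM to win; `wins_of_killOrAuxJInf` is relative to an invariant class `P`, and `P := Reachable
(initial)` is the weakest class the registered composition consumes (cf. the `P`-generic `KillOrAuxRuleJInfOn`, p606842).
* `GModel.Reachable M₀ M` (inductive), `GModel.KillAlt` / `GModel.AuxAlt` (the two disjuncts of the rule of record, verbatim), `killOrAuxRuleJInf_iff` (`Iff.rfl`);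
* `KillOrAuxRuleJInfReach p` — KILL ∨ AUX at every non-terminal model REACHABLE from the initial model of a crux datum (binders of `WinningStrategy p` verbatim);
  halves `KillHalfReach p` (K) / `AuxHalfReach p` (A); `killOrAuxRuleJInfReach_of_killOrAuxRuleJInf` (nothing is lost), `killOrAuxRuleJInfReach_of_halves`;
* (A0) `AuxCentreContainsTop p` — necessary condition for an aux move to lower `jInf` (research-M).
-/

set_option linter.dupNamespace false

noncomputable section

open CategoryTheory Limits AlgebraicGeometry TopologicalSpace
open Literature.AlgebraicGeometry.Resolution Literature.AlgebraicGeometry.RelativeSpec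
open Summit.ResolutionOfSingularities.ResolutionOfSingularities.Theorems.WildQuotientResolution.S1
open Summit.ResolutionOfSingularities.ResolutionOfSingularities.Theorems.WildQuotientResolution.S1.NodeAtlas
open Summit.ResolutionOfSingularities.ResolutionOfSingularities.Theorems.WildQuotientResolution.S1.GameFrame

namespace Summit.ResolutionOfSingularities.ResolutionOfSingularities.Theorems.WildQuotientResolution.S1

namespace GameFrame.GModel

variable {p : ℕ} {X' X₁ : Scheme.{0}} {q : X' ⟶ X₁} {G : Type} [Group G] {ρ : G →* Aut X'} {g₀ : G}

/-- **Reachable** `M₀ M`: `M` is obtained from `M₀` by finitely many ADMISSIBLE moves of the game. [OURS · L1 W4.5c · plan-1 SIG KA v1] -/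
inductive Reachable (M₀ : GModel p q G ρ g₀) : GModel p q G ρ g₀ → Prop
  | refl : Reachable M₀ M₀
  | move {M M' : GModel p q G ρ g₀} (𝒦 : ReesFiltration M.V) (d : ℕ) :
      Reachable M₀ M → IsAdmissibleCentre p M.act g₀ 𝒦 d → M.IsMoveOf M' 𝒦 d → Reachable M₀ M'

/-- **KILL alternative** of the rule of record at `M` (verbatim first disjunct of `KillOrAuxRuleJInf`). [OURS · plan-1 SIG KA v1] -/
def KillAlt (M : GModel p q G ρ g₀) : Prop :=
  ∃ (𝒦 : ReesFiltration M.V) (d : ℕ), IsPrincipalCentre p M.act g₀ 𝒦 d ∧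
    (∀ t ∈ irreducibleComponents ↥M.badLocus, ∃ x ∈ t, (x : M.V) ∈ M.principalKillOpen 𝒦 d) ∧
    ∀ M' : GModel p q G ρ g₀, M.IsMoveOf M' 𝒦 d → M'.jInf ≤ M.jInf

/-- **AUX alternative** of the rule of record at `M` (verbatim second disjunct of `KillOrAuxRuleJInf`). [OURS · plan-1 SIG KA v1] -/
def AuxAlt (M : GModel p q G ρ g₀) : Prop :=
  ∃ (𝒦 : ReesFiltration M.V) (d : ℕ), IsAuxCentre p M.act g₀ 𝒦 d (M.badLocus)ᶜ ∧
    ∀ M' : GModel p q G ρ g₀, M.IsMoveOf M' 𝒦 d → M'.jInf < M.jInf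

/-- The rule of record at `M` is literally `KillAlt M ∨ AuxAlt M`. -/
theorem killOrAuxRuleJInf_iff (p : ℕ) : KillOrAuxRuleJInf p ↔
    ∀ ⦃X' X₁ : Scheme.{0}⦄ (q : X' ⟶ X₁) (G : Type) [Group G] [Finite G] (ρ : G →* Aut X') (g₀ : G),
      (∀ g : G, g ∈ Subgroup.zpowers g₀) →
      ∀ M : GModel p q G ρ g₀, M.HasNoetherianBase → ¬ M.Terminal → M.KillAlt ∨ M.AuxAlt :=
  Iff.rfl

end GameFrame.GModel

/-- **THE DATUM-RELATIVE RULE `KillOrAuxRuleJInfReach p`** (plan-1 g12 SIG KA v1; OURS CANDIDATE, asserted nowhere): for every CRUX DATUM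
(binders of `FrameWins.WinningStrategy p`, verbatim) and every model REACHABLE from its initial model by admissible moves, non-terminal ⇒
KILL ∨ AUX (the alternatives of the rule of record, measure `jInf`). [OURS · L1 W4.5c] -/
def KillOrAuxRuleJInfReach (p : ℕ) : Prop :=
  ∀ (k : Type) [Field k] [CharP k p] [PerfectField k] (X' X₁ : Scheme.{0})
    (f : X₁ ⟶ Spec (.of k)) (q : X' ⟶ X₁) (G : Type) [Group G] [Finite G]
    (ρ : G →* Aut X'), Nat.card G = p → IsSeparated f → LocallyOfFiniteType f → QuasiCompact f →
    IsIntegral X₁ → ∀ [IsIntegral X'], Scheme.IsRegular X' → IsFinite q → Function.Surjective q.base →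
    (∃ U : X₁.Opens, Dense (U : Set X₁) ∧ Etale (q ∣_ U)) →
    ∀ (hq : ∀ g : G, (ρ g).hom ≫ q = q),
    (∀ x y : X', q.base x = q.base y → ∃ g : G, (ρ g).hom.base x = y) →
    topologicalKrullDim X₁ ≤ 4 → Function.Injective ρ →
    ∀ (g₀ : G), (∀ g : G, g ∈ Subgroup.zpowers g₀) → ∀ [IsLocallyNoetherian X']
      (h₀ : NodeAtlas p (⟨ρ, hq⟩ : ActionOver q G) g₀),
      ∀ M : GameFrame.GModel p q G ρ g₀, (GameFrame.GModel.initial hq h₀).Reachable M → ¬ M.Terminal →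
        M.KillAlt ∨ M.AuxAlt

/-- **(K) relative** — the KILL HALF on reachable models of crux data: `jInf M = ⊥` (every bad point killable), non-terminal ⇒ KILL. -/
def KillHalfReach (p : ℕ) : Prop :=
  ∀ (k : Type) [Field k] [CharP k p] [PerfectField k] (X' X₁ : Scheme.{0})
    (f : X₁ ⟶ Spec (.of k)) (q : X' ⟶ X₁) (G : Type) [Group G] [Finite G]
    (ρ : G →* Aut X'), Nat.card G = p → IsSeparated f → LocallyOfFiniteType f → QuasiCompact f →
    IsIntegral X₁ → ∀ [IsIntegral X'], Scheme.IsRegular X' → IsFinite q → Function.Surjective q.base →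
    (∃ U : X₁.Opens, Dense (U : Set X₁) ∧ Etale (q ∣_ U)) →
    ∀ (hq : ∀ g : G, (ρ g).hom ≫ q = q),
    (∀ x y : X', q.base x = q.base y → ∃ g : G, (ρ g).hom.base x = y) →
    topologicalKrullDim X₁ ≤ 4 → Function.Injective ρ →
    ∀ (g₀ : G), (∀ g : G, g ∈ Subgroup.zpowers g₀) → ∀ [IsLocallyNoetherian X']
      (h₀ : NodeAtlas p (⟨ρ, hq⟩ : ActionOver q G) g₀),
      ∀ M : GameFrame.GModel p q G ρ g₀, (GameFrame.GModel.initial hq h₀).Reachable M → ¬ M.Terminal →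
        M.jInf = ⊥ → M.KillAlt

/-- **(A) relative** — the AUX HALF on reachable models of crux data: `jInf M ≠ ⊥` (some bad point non-killable) ⇒ AUX. -/
def AuxHalfReach (p : ℕ) : Prop :=
  ∀ (k : Type) [Field k] [CharP k p] [PerfectField k] (X' X₁ : Scheme.{0})
    (f : X₁ ⟶ Spec (.of k)) (q : X' ⟶ X₁) (G : Type) [Group G] [Finite G]
    (ρ : G →* Aut X'), Nat.card G = p → IsSeparated f → LocallyOfFiniteType f → QuasiCompact f →
    IsIntegral X₁ → ∀ [IsIntegral X'], Scheme.IsRegular X' → IsFinite q → Function.Surjective q.base →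
    (∃ U : X₁.Opens, Dense (U : Set X₁) ∧ Etale (q ∣_ U)) →
    ∀ (hq : ∀ g : G, (ρ g).hom ≫ q = q),
    (∀ x y : X', q.base x = q.base y → ∃ g : G, (ρ g).hom.base x = y) →
    topologicalKrullDim X₁ ≤ 4 → Function.Injective ρ →
    ∀ (g₀ : G), (∀ g : G, g ∈ Subgroup.zpowers g₀) → ∀ [IsLocallyNoetherian X']
      (h₀ : NodeAtlas p (⟨ρ, hq⟩ : ActionOver q G) g₀),
      ∀ M : GameFrame.GModel p q G ρ g₀, (GameFrame.GModel.initial hq h₀).Reachable M → ¬ M.Terminal →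
        M.jInf ≠ ⊥ → M.AuxAlt

/-- **(A0) — NECESSARY CONDITION FOR AUX** (research statement, M-sized; plan-1 g12): if an admissible move strictly lowers `jInf`, the
SUPPORT of the centre contains every irreducible component of the non-killable locus of top dimension `jInf M` (off the support the
blow-up is an isomorphism and killability is local — needs the chart-shrinking lemma `PrincipalCentreChartShrink` of SIG v3). -/
def AuxCentreContainsTop (p : ℕ) : Prop :=
  ∀ ⦃X' X₁ : Scheme.{0}⦄ (q : X' ⟶ X₁) (G : Type) [Group G] [Finite G] (ρ : G →* Aut X') (g₀ : G)
    (M M' : GameFrame.GModel p q G ρ g₀) (𝒦 : ReesFiltration M.V) (d : ℕ),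
    IsAdmissibleCentre p M.act g₀ 𝒦 d → M.IsMoveOf M' 𝒦 d → M'.jInf < M.jInf →
    ∀ t ∈ irreducibleComponents ↥M.nonKillable, topologicalKrullDim ↥t = M.jInf →
      Subtype.val '' t ⊆ ((𝒦.ideal d).support : Set M.V)

/-! ## Proofs: nothing is lost, the halves assemble, and the relative rule closes the registered stub -/

/-- Nothing is lost: the rule of record implies the datum-relative rule. [OURS · plan-1 SIG KA v1] -/
theorem killOrAuxRuleJInfReach_of_killOrAuxRuleJInf {p : ℕ} (h : KillOrAuxRuleJInf p) : KillOrAuxRuleJInfReach p := by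
  intro k _ _ _ X' X₁ f q G _ _ ρ _ _ hfft hfqc _ _ _ _ _ _ hq _ _ _ g₀ hg₀ _ h₀ M _ hT
  haveI := hfft
  haveI := hfqc
  exact h q G ρ g₀ hg₀ M (GameFrame.GModel.hasNoetherianBase_of_datum f M) hT

/-- The two relative halves assemble to the relative rule (case split on `jInf M = ⊥`). [OURS · plan-1 SIG KA v1] -/
theorem killOrAuxRuleJInfReach_of_halves {p : ℕ} (hK : KillHalfReach p) (hA : AuxHalfReach p) : KillOrAuxRuleJInfReach p := by
  intro k _ _ _ X' X₁ f q G _ _ ρ hG hfs hfft hfqc hX₁ _ hreg hqfin hqs hqet hq horb hdim hinj g₀ hg₀ _ h₀ M hR hT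
  by_cases hj : M.jInf = ⊥
  · exact Or.inl (hK k X' X₁ f q G ρ hG hfs hfft hfqc hX₁ hreg hqfin hqs hqet hq horb hdim hinj g₀ hg₀ h₀ M hR hT hj)
  · exact Or.inr (hA k X' X₁ f q G ρ hG hfs hfft hfqc hX₁ hreg hqfin hqs hqet hq horb hdim hinj g₀ hg₀ h₀ M hR hT hj)

end Summit.ResolutionOfSingularities.ResolutionOfSingularities.Theorems.WildQuotientResolution.S1

end
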